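import Literature.NumberTheory.EllipticCurves.NeronModel
import Literature.AlgebraicGeometry.Motives.GoodReduction
import Literature.AlgebraicGeometry.Motives.AbelianVariety
import Literature.AlgebraicGeometry.Motives.IntegralModelBaseChange
import HarnessLib

/-!
# Transport of a group-scheme structure to an integral model along an isomorphism (road W, node (W6t))

Topic `Literature/NumberTheory/DiophantineGeometry`, namespace `Literature.AlgebraicGeometry.Motives.IntegralModel`.
THEOREMS ONLY.  Cell `hodgecm-mathlib` (D-0151), fan B-III (T1) road W, sub-line `koizumi_strictly_local` of the crux
workfile `Cruxes/H21/Lines/r0_koizumi.lean` (v3 b790cc39): node **(W6t) transport** — the last step of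
`KoizumiStrictlyLocal`: once Weil's group-chunk theorem and purity have produced an `R′`-group scheme `G` and an
isomorphism `u : 𝒳′ ≅ G` of `R′`-schemes extending the generic identification `𝒳′_{K′} ≅ A′` (W1, W23), the group
structure of `G` transports to the model `𝒳′` and the model's OWN generic isomorphism becomes a homomorphism of group
schemes.  Pure bookkeeping over Mathlib (`GrpObj.ofIso`, `isMonHom_ofIso`, functoriality of `IsMonHom` under the
monoidal generic-fibre functor `genericFibre R′ K′ = Over.pullback`); no hypothesis on the base ring.
Banked leaf toward road W (r₀); no floor change.

§2 (transport along `IntegralModel.baseChange`, A-p04 ★ p631162): if the model `𝒳` over `R` carries a group structure for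
which its generic isomorphism `𝒳_K ≅ A` is a homomorphism, then so does the base-changed model `𝒳 ⊗_R R′` over `R′`
(induced structure, Mathlib `Functor.grpObjObj` along `Over.pullback`) with respect to `(A ⊗_K K′)`: its generic
isomorphism is the exchange isomorphism `(𝒳 ⊗_R R′) ⊗_{R′} K′ ≅ (𝒳 ⊗_R K) ⊗_K K′` — a component of a natural isomorphism of
composites of cartesian-monoidal base-change functors, hence a homomorphism for the iterated induced structures
(`isMonHom_app_of_comp_comp`, the tree's pattern from `AbelianVarietyGoodReductionHomConjFrob` §1) — followed by
`genericIso ⊗_K K′`.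

## References
* S. Bosch, W. Lütkebohmert, M. Raynaud, *Néron Models*, Springer 1990, §1.2 Prop. 6 (the group structure of a Néron
  model is determined by its generic fibre), §4.3–§5.1 (from birational group laws to group schemes). [BLRNeronModels1990]
* S. Koizumi, *On specialization of the Albanese and Picard varieties*, Mem. Coll. Sci. Univ. Kyoto A 32 (1960),
  Thm. p. 377. [Koizumi1960]
-/

noncomputable section

open CategoryTheory AlgebraicGeometry
open scoped MonObj CategoryTheory.Obj

universe u

namespace Literature.AlgebraicGeometry.Motives

namespace IntegralModel

open Literature.NumberTheory.EllipticCurves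

variable {R' K' : Type u} [CommRing R'] [Field K'] [Algebra R' K']

/-- **(W6t) transport.**  Let `𝒳′` be an integral model over `R′` of (the variety underlying) an abelian variety
`A′ / K′`, `G → Spec R′` a group scheme and `u : 𝒳′ ≅ G` an isomorphism of `R′`-schemes which extends the generic
identification: `u_{K′} ≫ e = genericIso` for an isomorphism of GROUP schemes `e : G_{K′} ≅ A′`.  Then `𝒳′` carries a
group-scheme structure (the transport of `G`'s along `u`) for which its own generic isomorphism `𝒳′_{K′} ≅ A′` is a
homomorphism of group schemes — the conclusion of `KoizumiStrictlyLocal`.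
[cite: BLRNeronModels1990, §1.2 Prop. 6] [cite: Koizumi1960, Thm. p. 377] -/
theorem exists_grpObj_isMonHom_genericIso_of_iso {A' : AbelianVariety K'} (𝒳' : IntegralModel R' K' A'.X)
    (G : Over (Spec (.of R'))) [GrpObj G] (u : 𝒳'.total ≅ G)
    (e : (genericFibre R' K').obj G ≅ A'.X) [IsMonHom e.hom]
    (hu : (genericFibre R' K').map u.hom ≫ e.hom = 𝒳'.genericIso.hom) :
    ∃ _ : GrpObj 𝒳'.total,
      IsMonHom (M := (genericFibre R' K').obj 𝒳'.total) (N := A'.X) 𝒳'.genericIso.hom := by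
  letI : GrpObj 𝒳'.total := GrpObj.ofIso u.symm
  haveI : IsMonHom u.symm.hom := isMonHom_ofIso u.symm
  haveI : IsMonHom u.hom := inferInstanceAs (IsMonHom u.symm.inv)
  haveI : IsMonHom ((genericFibre R' K').map u.hom ≫ e.hom) := inferInstance
  refine ⟨inferInstance, ?_⟩
  rw [← hu]
  infer_instance

/-- The same with the comparison stated on the generic fibre of `G`: `u_{K′} = genericIso ≫ e⁻¹`.
[cite: BLRNeronModels1990, §1.2 Prop. 6] -/
theorem exists_grpObj_isMonHom_genericIso_of_iso' {A' : AbelianVariety K'} (𝒳' : IntegralModel R' K' A'.X)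
    (G : Over (Spec (.of R'))) [GrpObj G] (u : 𝒳'.total ≅ G)
    (e : (genericFibre R' K').obj G ≅ A'.X) [IsMonHom e.hom]
    (hu : (genericFibre R' K').map u.hom = 𝒳'.genericIso.hom ≫ e.inv) :
    ∃ _ : GrpObj 𝒳'.total,
      IsMonHom (M := (genericFibre R' K').obj 𝒳'.total) (N := A'.X) 𝒳'.genericIso.hom :=
  𝒳'.exists_grpObj_isMonHom_genericIso_of_iso G u e (by
    rw [hu]
    erw [Category.assoc, e.inv_hom_id, Category.comp_id]
    try rfl)

end IntegralModel

/-! ### §2 Transport along `IntegralModel.baseChange` -/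

section Monoidal

universe v₁ v₂ v₃ v₄ u₁ u₂ u₃ u₄

variable {C : Type u₁} [Category.{v₁} C] [CartesianMonoidalCategory C]
  {D : Type u₂} [Category.{v₂} D] [CartesianMonoidalCategory D]
  {D' : Type u₃} [Category.{v₃} D'] [CartesianMonoidalCategory D']
  {E : Type u₄} [Category.{v₄} E] [CartesianMonoidalCategory E]

/-- For cartesian-monoidal functors `F, G, F′, G′` and a natural isomorphism `α : F ⋙ G ≅ F′ ⋙ G′`, the component
`α_X : G (F X) ⟶ G′ (F′ X)` at a group object `X` is a homomorphism for the ITERATED induced group structures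
(`Functor.grpObjObj` twice on each side): it underlies the isomorphism of group objects
`mapGrpCompIso⁻¹ ≫ mapGrpNatIso α ≫ mapGrpCompIso`.
-- adapted from `Literature/AlgebraicGeometry/Motives/AbelianVarietyGoodReductionHomConjFrob.lean` §1 (private there)
[folklore] -/
private theorem isMonHom_app_of_comp_comp (F : C ⥤ D) (G : D ⥤ E) (F' : C ⥤ D') (G' : D' ⥤ E)
    [F.Monoidal] [G.Monoidal] [F'.Monoidal] [G'.Monoidal] (α : F ⋙ G ≅ F' ⋙ G') (X : C) [GrpObj X] :
    @IsMonHom E _ _ (G.obj (F.obj X)) (G'.obj (F'.obj X)) (Functor.monObjObj (F := G) (X := F.obj X))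
      (Functor.monObjObj (F := G') (X := F'.obj X)) (α.hom.app X) := by
  let I : (F.mapGrp ⋙ G.mapGrp).obj (Grp.mk X) ≅ (F'.mapGrp ⋙ G'.mapGrp).obj (Grp.mk X) :=
    ((Functor.mapGrpCompIso (F := F) (G := G)).symm ≪≫ Functor.mapGrpNatIso α ≪≫
      Functor.mapGrpCompIso (F := F') (G := G')).app (Grp.mk X)
  have hI : IsMonHom I.hom.hom.hom := inferInstance
  have h : I.hom.hom.hom = α.hom.app X := by
    simp only [I, Iso.trans_hom, Iso.symm_hom, Iso.app_hom, NatTrans.comp_app, Grp.comp_hom_hom,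
      Functor.mapGrpCompIso_inv_app_hom_hom, Functor.mapGrpNatIso_hom_app_hom_hom,
      Functor.mapGrpCompIso_hom_app_hom_hom]
    exact (Category.id_comp _).trans (Category.comp_id _)
  rw [h] at hI
  exact hI

/-- Composition of homomorphisms with the `MonObj` structures as explicit (implicit) arguments — term-mode glue for
structures that are only definitionally the instances found by class resolution. [folklore] -/
private theorem isMonHom_comp_of_isMonHom {M N O : C} {iM : MonObj M} {iN : MonObj N} {iO : MonObj O}
    {f : M ⟶ N} {g : N ⟶ O} (hf : IsMonHom f) (hg : IsMonHom g) : IsMonHom (f ≫ g) :=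
  instIsMonHomComp f g

end Monoidal

namespace IntegralModel

open Literature.NumberTheory.EllipticCurves

variable {R K : Type u} [CommRing R] [Field K] [Algebra R K]
  (R' K' : Type u) [CommRing R'] [Field K'] [Algebra R R'] [Algebra R' K'] [Algebra K K'] [Algebra R K']
  [IsScalarTower R R' K'] [IsScalarTower R K K']

/-- **(W6t) transport along base change of models.**  If the integral model `𝒳` over `R` of (the variety underlying) an
abelian variety `A / K` carries a group-scheme structure for which its generic isomorphism `𝒳_K ≅ A` is a homomorphism,
then the base-changed model `𝒳 ⊗_R R′` over `R′` (`IntegralModel.baseChangeAbelianVariety`, a model of `A ⊗_K K′`)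
carries one — the structure induced along the cartesian-monoidal base change `Over.pullback (Spec R′ → Spec R)` — for
which ITS generic isomorphism `(𝒳 ⊗_R R′)_{K′} ≅ A ⊗_K K′` is a homomorphism: that isomorphism is the exchange isomorphism
`(𝒳 ⊗_R R′) ⊗_{R′} K′ ≅ (𝒳 ⊗_R K) ⊗_K K′` (a homomorphism for the iterated induced structures, `isMonHom_app_of_comp_comp`)
followed by `genericIso ⊗_K K′` (a homomorphism by functoriality). [cite: BLRNeronModels1990, §1.2 Prop. 6]
[cite: GortzWedhorn2020, Prop. 4.16 and §(4.7)] -/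
theorem exists_grpObj_isMonHom_genericIso_baseChange {A : AbelianVariety K} (𝒳 : IntegralModel R K A.X)
    [GrpObj 𝒳.total] (h : IsMonHom (M := (genericFibre R K).obj 𝒳.total) (N := A.X) 𝒳.genericIso.hom) :
    ∃ _ : GrpObj (𝒳.baseChangeAbelianVariety R' K').total,
      IsMonHom (M := (genericFibre R' K').obj (𝒳.baseChangeAbelianVariety R' K').total)
        (N := (A.baseChange K').X) (𝒳.baseChangeAbelianVariety R' K').genericIso.hom := by
  letI iG : GrpObj (𝒳.baseChangeAbelianVariety R' K').total :=
    Functor.grpObjObj (F := Over.pullback (Spec.map (CommRingCat.ofHom (algebraMap R R')))) (G := 𝒳.total)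
  refine ⟨iG, ?_⟩
  -- the exchange isomorphism is a homomorphism for the iterated induced structures
  have h1 := isMonHom_app_of_comp_comp
    (Over.pullback (Spec.map (CommRingCat.ofHom (algebraMap R R'))))
    (Over.pullback (Spec.map (CommRingCat.ofHom (algebraMap R' K'))))
    (Over.pullback (Spec.map (CommRingCat.ofHom (algebraMap R K))))
    (Over.pullback (Spec.map (CommRingCat.ofHom (algebraMap K K'))))
    (baseChangeGenericNatIso R' K') 𝒳.total
  -- `genericIso ⊗_K K′` is a homomorphism by functoriality
  haveI := h
  have h2 : IsMonHom
      (M := (Over.pullback (Spec.map (CommRingCat.ofHom (algebraMap K K')))).obj ((genericFibre R K).obj 𝒳.total))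
      (N := (Over.pullback (Spec.map (CommRingCat.ofHom (algebraMap K K')))).obj A.X)
      ((Over.pullback (Spec.map (CommRingCat.ofHom (algebraMap K K')))).map 𝒳.genericIso.hom) :=
    Functor.map.instIsMonHom _ _ _
  exact isMonHom_comp_of_isMonHom h1 h2

end IntegralModel

end Literature.AlgebraicGeometry.Motives

end
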